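import Summits.QuantumFields.YangMills.Theorems.BalabanUVNodesN19LipschitzLinksDegreeBudgetLog
import Summits.QuantumFields.YangMills.Theorems.BalabanUVNodesN19SingleModeMomentLogFreeBudget

/-!
# YM-DAG node N19 (= NE7 proper) — THE MOMENT-CURRENCY LADDER BUDGET WITH THE RE-BALANCED SCALE (parameters and bookkeeping, ONE logarithm)
# (`L_F = ⌊L∕(12000 log₂L)⌋`, `2^J` the least power of two `≥ 2π²L_F`, log-mass `≤ L∕2`; sup error `≤ 171700·K·d·log₂L∕L`)

Cell `pub-ymgap`, HUMAN RULING D-0062 (Track A) ∕ D-0149 (work-bound push), R141 (C) wider-strategy seat `pub-ymgap-dag-n19-e` (strategy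
s3 = ALTERNATIVE CURRENCY), generation g34, module 4 (lineage module 179).  Route `Summits/QuantumFields/YangMills/Theses/BalabanUVNodes.lean`,
cluster item K3⁸ «SpineGivenEndpointR13SepCoPHV» (stmt-QuantumFields-27366); filed `--supports` that item `--as helper` (it proves no registered
stub).  COUNT-NEUTRAL: [bookkeeping] over Mathlib and, BY NAME, module 176 `…N19LipschitzLinksDegreeBudgetLog` (`exists_pow_two_ge_lt`) and module
145 `…N19SingleModeMomentLogFreeBudget` (`exists_order_L`); no laws, no scheme object, no Theses import; NOT a discharge claim.

ROLE IN THE LINEAGE.  Module 170 priced every `K`-Lipschitz link of `Σ_i|x_i|` at `3·10⁶·K·d·log₂²L∕L` for laws with `e^{−L}`-close mixed moments,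
with module 145's scale `2^J ≍ √(aL)` (designed for the single mode).  As in module 176 the second-order remainder `Kdπ³L_F∕4^J` of module 155's law
only has to beat the smoothing error `≍ Kd∕L_F`, so `2^J` = the least power of two `≥ 2π²L_F` suffices; then every term of module 155's LOG-MASS is
`≍ L_F·log₂L` (`6πe²a·log(1 + 10a)`, `3πe²a(J+1)log 81`, `h(2^{J+1} − 1)log 81` with `a = 2L_Fπ`, `2^J ≤ 2πa`, `J + 1 ≤ log₂L`, `h ≤ 2.2log₂L`) or
`≤ 0.14L` (`N log 9`, `N = ⌊L∕16⌋`), and the budget `≤ L∕2` closes with `L_F = ⌊L∕(12000 log₂L)⌋` — ONE logarithm.  §1 `logb_le_L20` (`Λ ≥ 20`,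
`36000Λ ≤ L`, `100Λ³ ≤ L` for `L ≥ 2^20`), `logmass_le_linear`, `exists_parameters_L1`; §2 `errorBound_L1` (smoothing `170200KdΛ∕L`, second order
`1440KdΛ∕L`, first order `54Kd∕L`, ladder `19Kd∕L`).  The sequel (`…N19LipschitzLinksMomentBudgetLog`) concludes `≤ 3.5·10⁵·K·d·log₂L∕L`.

HONEST FRAMING (binding).  Elementary bookkeeping; constants astronomical, nowhere optimised; NO consumer in the DAG today (the seat's own currency
map); nothing of Bałaban's instantiated; NE7 NOT PRINTED, NOT proved; N19 NOT discharged; count-neutral.  One finite `T⁴` programme at fixed `ε`;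
nothing continuum ∕ `ℝ⁴` ∕ OS ∕ mass-gap ∕ Clay.  0 `def` ∕ 0 `sorry`.
-/

noncomputable section

open Finset
open scoped Real

namespace Summit.QuantumFields.YangMills.Theorems.BalabanUVNodesN19MomentBudgetLinearParameters

open Summit.QuantumFields.YangMills.Theorems.BalabanUVNodesN19LipschitzLinksDegreeBudgetLog (exists_pow_two_ge_lt)
open Summit.QuantumFields.YangMills.Theorems.BalabanUVNodesN19SingleModeMomentLogFreeBudget (exists_order_L)

/-! ## §1 The parameters at budget `L` [bookkeeping] -/

/-- `log₂L ≥ 20`, `36000·log₂L ≤ L` and `100·log₂³L ≤ L` for real `L ≥ 2^20` (`1 + v log 2 ≤ 2^v`, `(1 + v∕20)³ ≤ e^{3v∕20} ≤ 2^v`). [bookkeeping] -/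
theorem logb_le_L20 {L : ℝ} (hL : (2 : ℝ) ^ (20 : ℕ) ≤ L) :
    20 ≤ Real.logb 2 L ∧ 36000 * Real.logb 2 L ≤ L ∧ 100 * Real.logb 2 L ^ 3 ≤ L := by
  set u : ℝ := Real.logb 2 L with hu
  have hL0 : 0 < L := lt_of_lt_of_le (by positivity) hL
  have hu20 : 20 ≤ u := by
    rw [hu, Real.le_logb_iff_rpow_le one_lt_two hL0, show (20 : ℝ) = ((20 : ℕ) : ℝ) by norm_num, Real.rpow_natCast]; exact hL
  have hLu : L = 2 ^ u := by rw [hu, Real.rpow_logb two_pos (by norm_num) hL0]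
  set v : ℝ := u - 20 with hv
  have hv0 : 0 ≤ v := by linarith
  have h2u : (2 : ℝ) ^ u = 2 ^ (20 : ℝ) * 2 ^ v := by rw [← Real.rpow_add two_pos]; congr 1; ring
  have h20 : (2 : ℝ) ^ (20 : ℝ) = 1048576 := by rw [show (20 : ℝ) = ((20 : ℕ) : ℝ) by norm_num, Real.rpow_natCast]; norm_num
  have hlog2 : 0.6931 < Real.log 2 := by linarith only [Real.log_two_gt_d9]
  have h2v : Real.exp (v * Real.log 2) = (2 : ℝ) ^ v := by rw [Real.rpow_def_of_pos two_pos, mul_comm]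
  have hlin : 1 + 0.6931 * v ≤ (2 : ℝ) ^ v := by
    have := Real.add_one_le_exp (v * Real.log 2)
    rw [h2v] at this; nlinarith only [this, hlog2, hv0]
  have hcube : (1 + v / 20) ^ 3 ≤ (2 : ℝ) ^ v := by
    have h1 : 1 + v / 20 ≤ Real.exp (v / 20) := by have := Real.add_one_le_exp (v / 20); linarith
    have h2 : (1 + v / 20) ^ 3 ≤ Real.exp (v / 20) ^ 3 := pow_le_pow_left₀ (by linarith) h1 3
    have h3 : Real.exp (v / 20) ^ 3 = Real.exp (3 * v / 20) := by rw [← Real.exp_nat_mul]; congr 1; push_cast; ring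
    have h4 : Real.exp (3 * v / 20) ≤ Real.exp (v * Real.log 2) := Real.exp_le_exp.2 (by nlinarith only [hlog2, hv0])
    rw [← h2v]; linarith only [h2, h3.le, h3.ge, h4]
  have h2v0 : 0 ≤ (2 : ℝ) ^ v := Real.rpow_nonneg (by norm_num) v
  refine ⟨hu20, ?_, ?_⟩
  · calc 36000 * u = 720000 + 36000 * v := by rw [hv]; ring
      _ ≤ 1048576 * (1 + 0.6931 * v) := by nlinarith only [hv0]
      _ ≤ 1048576 * (2 : ℝ) ^ v := by nlinarith only [hlin]
      _ = L := by rw [hLu, h2u, h20]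
  · have husq : u ^ 3 = 8000 * (1 + v / 20) ^ 3 := by rw [hv]; ring
    calc 100 * u ^ 3 = 800000 * (1 + v / 20) ^ 3 := by rw [husq]; ring
      _ ≤ 800000 * (2 : ℝ) ^ v := by nlinarith only [hcube]
      _ ≤ 1048576 * (2 : ℝ) ^ v := by nlinarith only [h2v0]
      _ = L := by rw [hLu, h2u, h20]

/-- **THE LOG-MASS BUDGET WITH THE RE-BALANCED SCALE.**  Let `L ≥ 2^20`, `Λ = log₂L`, `a ≥ 0` with `aΛ ≤ L∕1900`, `0 ≤ J`, `J + 1 ≤ M ≤ 2πa`,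
`J + 1 ≤ Λ`, `h ≤ 2.2Λ`, `1 ≤ N ≤ L∕16`.  Then
`(J+1)log 2 + (6πe²a + h(J+1))log(1 + 10a) + (3πe²a(J+1) + h(2M − 1))log 81 + log(1 + 2aN9^N) ≤ L∕2`
(`log(1 + 10a) ≤ log L = Λ log 2`, `log 81 ≤ 4.437`, `log 9 ≤ 2.219`, `100Λ³ ≤ L`: the three `aΛ` terms total `≤ 531aΛ ≤ 0.28L`, `h(J+1)log(1+10a) ≤
1.53Λ³ ≤ 0.0153L`, `N log 9 ≤ 0.139L`). [bookkeeping] -/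
theorem logmass_le_linear {L a h M N Jr : ℝ} (hL : (2 : ℝ) ^ (20 : ℕ) ≤ L) (ha : 0 ≤ a) (haΛ : a * Real.logb 2 L ≤ L / 1900)
    (hJM : Jr + 1 ≤ M) (hJ0 : 0 ≤ Jr) (hJL : Jr + 1 ≤ Real.logb 2 L) (hMa : M ≤ 2 * π * a)
    (hh : h ≤ 2.2 * Real.logb 2 L) (hN1 : 1 ≤ N) (hN : N ≤ L / 16) :
    (Jr + 1) * Real.log 2 + (6 * π * Real.exp 2 * a + h * (Jr + 1)) * Real.log (1 + 10 * a) +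
        (3 * π * Real.exp 2 * a * (Jr + 1) + h * (2 * M - 1)) * Real.log 81 + Real.log (1 + 2 * a * (N * 9 ^ N)) ≤ L / 2 := by
  obtain ⟨hΛ20, hΛlin, hΛcube⟩ := logb_le_L20 hL
  set Lb : ℝ := Real.logb 2 L with hLb
  have hL0 : 0 < L := lt_of_lt_of_le (by positivity) hL
  have hLge : (1048576 : ℝ) ≤ L := le_trans (by norm_num) hL
  have hLb0 : 0 < Lb := by linarith only [hΛ20]
  have hπhi : π < 3.15 := Real.pi_lt_d2
  have hπ0 : 0 < π := Real.pi_pos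
  -- numerals
  have hlog2 : Real.log 2 ≤ 0.6932 := by linarith only [Real.log_two_lt_d9]
  have hlog2' : 0 < Real.log 2 := Real.log_pos one_lt_two
  have hlog81 : Real.log 81 ≤ 4.437 := by
    have h1 : Real.log ((81 : ℝ) ^ 5) ≤ Real.log ((2 : ℝ) ^ 32) := Real.log_le_log (by norm_num) (by norm_num)
    rw [Real.log_pow, Real.log_pow] at h1; push_cast at h1; linarith only [h1, hlog2]
  have hlog9 : Real.log 9 ≤ 2.219 := by
    have h1 : Real.log ((9 : ℝ) ^ 5) ≤ Real.log ((2 : ℝ) ^ 16) := Real.log_le_log (by norm_num) (by norm_num)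
    rw [Real.log_pow, Real.log_pow] at h1; push_cast at h1; linarith only [h1, hlog2]
  have he2 : Real.exp 2 ≤ 7.4 := by
    have he1 : Real.exp 1 ≤ 2.7182818286 := Real.exp_one_lt_d9.le
    have he0 : 0 < Real.exp 1 := Real.exp_pos 1
    have : Real.exp 2 = Real.exp 1 * Real.exp 1 := by rw [← Real.exp_add]; norm_num
    rw [this]; nlinarith only [he1, he0]
  have he20 : 0 < Real.exp 2 := Real.exp_pos 2
  have hπe : π * Real.exp 2 ≤ 3.15 * 7.4 := mul_le_mul hπhi.le he2 he20.le (by norm_num)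
  -- the regime in usable forms
  have haL : a ≤ L / 38000 := by
    have h1 : a * 20 ≤ a * Lb := mul_le_mul_of_nonneg_left hΛ20 ha
    rw [le_div_iff₀ (by norm_num : (0 : ℝ) < 38000)]; linarith only [h1, haΛ]
  have hlogL : Real.log L = Lb * Real.log 2 := by
    rw [hLb, Real.logb, div_mul_cancel₀ _ (Real.log_pos one_lt_two).ne']
  have hlogL' : Real.log L ≤ 0.6932 * Lb := by rw [hlogL, mul_comm]; exact mul_le_mul_of_nonneg_right hlog2 hLb0.le
  -- `log(1 + 10a) ≤ log L ≤ 0.6932Λ`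
  have hl10a : Real.log (1 + 10 * a) ≤ 0.6932 * Lb := by
    have h1 : 1 + 10 * a ≤ L := by linarith only [haL, hLge]
    exact (Real.log_le_log (by linarith) h1).trans hlogL'
  have hl10a0 : 0 ≤ Real.log (1 + 10 * a) := Real.log_nonneg (by linarith)
  -- `log(1 + 2aN9^N) ≤ 2a + log L + N log 9`
  have hN0 : 0 < N := by linarith
  have h9N : (1 : ℝ) ≤ 9 ^ N := Real.one_le_rpow (by norm_num) hN0.le
  have hlN : Real.log (1 + 2 * a * (N * 9 ^ N)) ≤ 2 * a + 0.6932 * Lb + N * Real.log 9 := by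
    have hprod : 1 + 2 * a * (N * 9 ^ N) ≤ (1 + 2 * a) * ((N + 1) * 9 ^ N) := by
      nlinarith only [ha, hN0, h9N, mul_nonneg (mul_nonneg ha hN0.le) (by linarith only [h9N] : (0 : ℝ) ≤ 9 ^ N)]
    have h1 : Real.log (1 + 2 * a * (N * 9 ^ N)) ≤ Real.log ((1 + 2 * a) * ((N + 1) * 9 ^ N)) :=
      Real.log_le_log (by positivity) hprod
    rw [Real.log_mul (by positivity) (by positivity), Real.log_mul (by positivity) (by positivity),
      Real.log_rpow (by norm_num)] at h1
    have h2 : Real.log (1 + 2 * a) ≤ 2 * a := by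
      have := Real.log_le_sub_one_of_pos (show 0 < 1 + 2 * a by linarith); linarith
    have h3 : Real.log (N + 1) ≤ 0.6932 * Lb := (Real.log_le_log (by linarith) (by linarith only [hN, hLge])).trans hlogL'
    linarith only [h1, h2, h3]
  -- the pieces
  have hM0 : 0 ≤ M := by linarith only [hJM, hJ0]
  have hT1 : (Jr + 1) * Real.log 2 ≤ 0.6932 * Lb := by nlinarith only [hJL, hlog2, hJ0, hlog2']
  have hT2a : 6 * π * Real.exp 2 * a * Real.log (1 + 10 * a) ≤ 96.98 * (a * Lb) := by
    have h1 : 6 * π * Real.exp 2 * a ≤ 139.9 * a := by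
      have := mul_le_mul_of_nonneg_right (show 6 * π * Real.exp 2 ≤ 139.9 by nlinarith only [hπe]) ha
      linarith only [this]
    calc 6 * π * Real.exp 2 * a * Real.log (1 + 10 * a) ≤ 139.9 * a * (0.6932 * Lb) := mul_le_mul h1 hl10a hl10a0 (by positivity)
      _ ≤ 96.98 * (a * Lb) := by nlinarith only [ha, hLb0]
  have hT2b : h * (Jr + 1) * Real.log (1 + 10 * a) ≤ 0.0153 * L := by
    have h1 : h * (Jr + 1) ≤ 2.2 * Lb * Lb := mul_le_mul hh hJL (by linarith) (by positivity)
    calc h * (Jr + 1) * Real.log (1 + 10 * a) ≤ 2.2 * Lb * Lb * (0.6932 * Lb) := mul_le_mul h1 hl10a hl10a0 (by positivity)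
      _ = 1.52504 * Lb ^ 3 := by ring
      _ ≤ 0.0153 * L := by nlinarith only [hΛcube, pow_pos hLb0 3]
  have hT3a : 3 * π * Real.exp 2 * a * (Jr + 1) * Real.log 81 ≤ 310.3 * (a * Lb) := by
    have h1 : 3 * π * Real.exp 2 * a ≤ 69.93 * a := by
      have := mul_le_mul_of_nonneg_right (show 3 * π * Real.exp 2 ≤ 69.93 by nlinarith only [hπe]) ha
      linarith only [this]
    have h2 : 3 * π * Real.exp 2 * a * (Jr + 1) ≤ 69.93 * a * Lb := mul_le_mul h1 hJL (by linarith) (by positivity)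
    calc 3 * π * Real.exp 2 * a * (Jr + 1) * Real.log 81 ≤ 69.93 * a * Lb * 4.437 :=
          mul_le_mul h2 hlog81 (Real.log_nonneg (by norm_num)) (by positivity)
      _ ≤ 310.3 * (a * Lb) := by nlinarith only [ha, hLb0]
  have hT3b : h * (2 * M - 1) * Real.log 81 ≤ 123.1 * (a * Lb) := by
    have h1 : h * (2 * M - 1) ≤ 2.2 * Lb * (2 * M) := by nlinarith only [hh, hJM, hJ0, hLb0]
    have h2 : 2.2 * Lb * (2 * M) ≤ 2.2 * Lb * (2 * (2 * π * a)) := by nlinarith only [hMa, hLb0]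
    have h3 : 2.2 * Lb * (2 * (2 * π * a)) ≤ 27.72 * (a * Lb) := by nlinarith only [hπhi, mul_nonneg ha hLb0.le]
    calc h * (2 * M - 1) * Real.log 81 ≤ 2.2 * Lb * (2 * M) * 4.437 :=
          mul_le_mul h1 hlog81 (Real.log_nonneg (by norm_num)) (by positivity)
      _ ≤ 27.72 * (a * Lb) * 4.437 := by nlinarith only [h2, h3]
      _ ≤ 123.1 * (a * Lb) := by nlinarith only [mul_nonneg ha hLb0.le]
  have hT4 : Real.log (1 + 2 * a * (N * 9 ^ N)) ≤ 2 * a + 0.6932 * Lb + 0.1387 * L := by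
    have h1 : N * Real.log 9 ≤ (L / 16) * 2.219 := mul_le_mul hN hlog9 (Real.log_nonneg (by norm_num)) (by positivity)
    linarith only [hlN, h1, hL0]
  have hsmall : 2 * a + 3 * (0.6932 * Lb) ≤ 0.001 * L := by
    have h1 : Lb ≤ L / 36000 := by rw [le_div_iff₀ (by norm_num : (0 : ℝ) < 36000)]; linarith only [hΛlin]
    linarith only [haL, h1, hL0]
  have e : (Jr + 1) * Real.log 2 + (6 * π * Real.exp 2 * a + h * (Jr + 1)) * Real.log (1 + 10 * a) +
      (3 * π * Real.exp 2 * a * (Jr + 1) + h * (2 * M - 1)) * Real.log 81 + Real.log (1 + 2 * a * (N * 9 ^ N)) =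
      (Jr + 1) * Real.log 2 + (6 * π * Real.exp 2 * a * Real.log (1 + 10 * a) + h * (Jr + 1) * Real.log (1 + 10 * a)) +
      (3 * π * Real.exp 2 * a * (Jr + 1) * Real.log 81 + h * (2 * M - 1) * Real.log 81) + Real.log (1 + 2 * a * (N * 9 ^ N)) := by
    ring
  rw [e]; linarith only [hT1, hT2a, hT2b, hT3a, hT3b, hT4, hsmall, haΛ, hL0, hLb0]

/-- **THE PARAMETERS AT BUDGET `L ≥ 2^20` (re-balanced scale).**  With `Λ = log₂L`: a Jackson order `L_F ≥ 1` with `L ≤ 18000Λ·L_F` and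
`12000Λ·L_F ≤ L`; the scale `2^J` = the least power of two `≥ 2π²L_F`; module 145's order `h` (`1 ≤ h ≤ 2.2Λ`, `e^{−h} ≤ L^{−3}`,
`(J+1)e^{−h} ≤ ½`, `J + 1 ≤ L∕4`); `N = ⌊L∕16⌋` (`2^J ≤ N`, `L∕17 ≤ N`); and the LOG-MASS BUDGET of `logmass_le_linear`. [bookkeeping] -/
theorem exists_parameters_L1 {L : ℝ} (hL : (2 : ℝ) ^ (20 : ℕ) ≤ L) :
    ∃ LF J h N : ℕ, 1 ≤ LF ∧ L ≤ 18000 * Real.logb 2 L * LF ∧ 12000 * Real.logb 2 L * LF ≤ L ∧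
      1 ≤ h ∧ ((J : ℝ) + 1) * Real.exp (-(h : ℝ)) ≤ 1 / 2 ∧ Real.exp (-(h : ℝ)) ≤ 1 / L ^ 3 ∧ (J : ℝ) + 1 ≤ L / 4 ∧
      2 * (LF : ℝ) * π * π ≤ 2 ^ J ∧ 2 ^ J ≤ N ∧ L / 17 ≤ N ∧
      ((J : ℝ) + 1) * Real.log 2 + (6 * π * Real.exp 2 * (2 * LF * π) + h * ((J : ℝ) + 1)) * Real.log (1 + 10 * (2 * LF * π)) +
          (3 * π * Real.exp 2 * (2 * LF * π) * ((J : ℝ) + 1) + h * (2 ^ (J + 1) - 1)) * Real.log 81 +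
          Real.log (1 + 2 * (2 * LF * π) * (N * 9 ^ N)) ≤ L / 2 := by
  obtain ⟨hΛ20, hΛlin, _⟩ := logb_le_L20 hL
  set Λ : ℝ := Real.logb 2 L with hΛ
  have hL0 : 0 < L := lt_of_lt_of_le (by positivity) hL
  have hLge : (1048576 : ℝ) ≤ L := le_trans (by norm_num) hL
  have hL1024 : (1024 : ℝ) ≤ L := by linarith
  have hπlo : 3.14 < π := Real.pi_gt_d2
  have hπhi : π < 3.15 := Real.pi_lt_d2
  have hΛ0 : 0 < Λ := by linarith
  -- the Jackson order
  set x : ℝ := L / (12000 * Λ) with hx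
  have hx3 : 3 ≤ x := by rw [hx, le_div_iff₀ (by positivity)]; linarith only [hΛlin]
  set LF : ℕ := ⌊x⌋₊ with hLF
  have hLFx : (LF : ℝ) ≤ x := Nat.floor_le (by linarith)
  have hxLF : x < LF + 1 := Nat.lt_floor_add_one x
  have hLF1 : 1 ≤ LF := by
    have h2 : (0 : ℝ) < LF := by linarith
    exact_mod_cast (show 0 < LF by exact_mod_cast h2)
  have hLFr : (1 : ℝ) ≤ LF := by exact_mod_cast hLF1
  have hP2 : L ≤ 18000 * Λ * LF := by
    have hLx : L = 12000 * Λ * x := by rw [hx]; field_simp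
    have hLF23 : 2 * x / 3 ≤ LF := by linarith only [hx3, hxLF]
    rw [hLx]
    have := mul_le_mul_of_nonneg_left hLF23 (by positivity : (0 : ℝ) ≤ 18000 * Λ)
    linarith only [this]
  have hP3 : 12000 * Λ * (LF : ℝ) ≤ L := by
    have := mul_le_mul_of_nonneg_left hLFx (by positivity : (0 : ℝ) ≤ 12000 * Λ)
    rw [hx, mul_div_cancel₀ _ (by positivity)] at this
    exact this
  have hLFsmall : 240000 * (LF : ℝ) ≤ L := by
    have h1 : 12000 * 20 * (LF : ℝ) ≤ 12000 * Λ * LF := by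
      have := mul_le_mul_of_nonneg_right hΛ20 (by positivity : (0 : ℝ) ≤ 12000 * LF)
      linarith only [this]
    linarith only [h1, hP3]
  -- the scale: the least power of two `≥ 2π²L_F`
  set a : ℝ := 2 * LF * π with ha
  have ha0 : 0 ≤ a := by positivity
  have hππlo : 9 < π * π := by nlinarith only [hπlo, Real.pi_pos]
  have hb : (1 : ℝ) < a * π := by
    have h0 : 0 ≤ ((LF : ℝ) - 1) * (π * π) := mul_nonneg (by linarith only [hLFr]) (by positivity)
    rw [ha]; nlinarith only [h0, hππlo, hLFr]
  obtain ⟨J, _, hJge, hJlt⟩ := exists_pow_two_ge_lt hb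
  have hM0 : (0 : ℝ) < 2 ^ J := by positivity
  have hMa : (2 : ℝ) ^ J ≤ 2 * π * a := by linarith only [hJlt]
  have hM40 : (2 : ℝ) ^ J ≤ 40 * LF := by
    have hππhi : π * π < 9.9225 := by nlinarith only [hπhi, Real.pi_pos]
    have h0 : 0 ≤ (LF : ℝ) * (9.9225 - π * π) := mul_nonneg (by positivity) (by linarith only [hππhi])
    rw [ha] at hMa; nlinarith only [hMa, h0]
  have hJ4 : (2 : ℝ) ^ J ≤ L / 4 := by
    rw [le_div_iff₀ (by norm_num : (0 : ℝ) < 4)]; linarith only [hM40, hLFsmall]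
  -- the order
  obtain ⟨h, hh1, hhle, hexph⟩ := exists_order_L hL1024
  have hJ12J : (J : ℝ) + 1 ≤ 2 ^ J := by exact_mod_cast (Nat.lt_two_pow_self : J + 1 ≤ 2 ^ J)
  have hJ1 : (J : ℝ) + 1 ≤ L / 4 := hJ12J.trans hJ4
  have hP5 : ((J : ℝ) + 1) * Real.exp (-(h : ℝ)) ≤ 1 / 2 := by
    calc ((J : ℝ) + 1) * Real.exp (-(h : ℝ)) ≤ (L / 4) * (1 / L ^ 3) := mul_le_mul hJ1 hexph (Real.exp_pos _).le (by positivity)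
      _ = 1 / (4 * L ^ 2) := by field_simp
      _ ≤ 1 / 2 := by rw [div_le_div_iff₀ (by positivity) (by norm_num : (0 : ℝ) < 2)]; nlinarith only [hLge]
  have hJ1Λ : (J : ℝ) + 1 ≤ Λ := by
    have h2J1 : (2 : ℝ) ^ (J + 1) ≤ L := by rw [pow_succ]; linarith only [hJ4, hL0, hM0]
    rw [hΛ, Real.le_logb_iff_rpow_le one_lt_two hL0]
    have e : (2 : ℝ) ^ ((J : ℝ) + 1) = 2 ^ (J + 1) := by rw [← Real.rpow_natCast]; push_cast; ring_nf
    rw [e]; exact h2J1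
  -- the Jackson order `N = ⌊L/16⌋`
  set N : ℕ := ⌊L / 16⌋₊ with hN
  have hNle : (N : ℝ) ≤ L / 16 := Nat.floor_le (by positivity)
  have hNge : L / 16 - 1 ≤ N := by have := Nat.lt_floor_add_one (L / 16); linarith
  have hN1 : (1 : ℝ) ≤ N := by linarith
  have hN17 : L / 17 ≤ N := by
    have : L / 17 ≤ L / 16 - 1 := by rw [div_le_iff₀ (by norm_num : (0 : ℝ) < 17)]; nlinarith only [hLge]
    linarith
  have hNJ : 2 ^ J ≤ N := by
    have h1 : ((2 ^ J : ℕ) : ℝ) ≤ (N : ℝ) := by push_cast; linarith only [hM40, hLFsmall, hNge, hLge]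
    exact_mod_cast h1
  -- the log-mass budget
  have haΛ : a * Λ ≤ L / 1900 := by
    have h1 : a * Λ ≤ 6.3 * (Λ * LF) := by
      rw [ha, show 2 * (LF : ℝ) * π * Λ = (2 * π) * (Λ * LF) by ring]
      exact mul_le_mul_of_nonneg_right (by linarith only [hπhi]) (by positivity)
    rw [le_div_iff₀ (by norm_num : (0 : ℝ) < 1900)]; linarith only [h1, hP3, hL0]
  have h9 : ((9 : ℝ) ^ N : ℝ) = (9 : ℝ) ^ ((N : ℕ) : ℝ) := (Real.rpow_natCast 9 N).symm
  have hbudget := logmass_le_linear (M := (2 : ℝ) ^ J) (N := (N : ℝ)) (Jr := (J : ℝ)) (h := (h : ℝ)) hL ha0 haΛ hJ12J (Nat.cast_nonneg J)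
    hJ1Λ hMa hhle hN1 hNle
  rw [← h9] at hbudget
  have e2 : (2 : ℝ) * 2 ^ J - 1 = 2 ^ (J + 1) - 1 := by rw [pow_succ]; ring
  rw [e2] at hbudget
  refine ⟨LF, J, h, N, hLF1, hP2, hP3, hh1, hP5, hexph, hJ1, ?_, hNJ, hN17, ?_⟩
  · rw [ha] at hJge; simpa [mul_assoc] using hJge
  · simpa [ha] using hbudget

/-! ## §2 The error bookkeeping at budget `L` [bookkeeping] -/

/-- THE SUP-ERROR BOOKKEEPING AT BUDGET `L` (`M = 2^J ≥ 2π²L_F`, `ε = 2(J+1)e^{−h} ≤ 1∕(2L²)`): smoothing `Kd(1∕π + 3π⁴∕32)∕L_F ≤ 170200KdΛ∕L`,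
second order `Kdπ³L_F∕M² ≤ Kd∕(4πL_F) ≤ 1440KdΛ∕L`, first order `≤ 54Kd∕L`, ladder `≤ 19Kd∕L`; total `≤ 171700KdΛ∕L`. [bookkeeping] -/
theorem errorBound_L1 {K d L Λ LF M N ε : ℝ} (hK : 0 ≤ K) (hd : 0 < d) (hL : 1048576 ≤ L) (hΛ : 20 ≤ Λ) (hLF1 : 1 ≤ LF)
    (hLFL : LF ≤ L) (hLLF : L ≤ 18000 * Λ * LF) (hM : 2 * LF * π * π ≤ M) (hMN : M ≤ N) (hN17 : L / 17 ≤ N)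
    (hε : ε ≤ 1 / (2 * L ^ 2)) :
    K * d * (1 / π + 3 * π ^ 4 / 32) / LF +
      (K * π * LF / d * (d * π / M) ^ 2 + K * (d * π / N) +
        ε * (π ^ 4 * (K * d) * LF / 8) * (1 + 2 * LF * π / d * (d * π / M + d * π / N))) ≤
        171700 * K * d * Λ / L := by
  have hπlo : 3.14 < π := Real.pi_gt_d2
  have hπhi : π < 3.15 := Real.pi_lt_d2
  have hπ := Real.pi_pos
  have hL0 : 0 < L := by linarith
  have hLF0 : 0 < LF := by linarith
  have hM0 : 0 < M := lt_of_lt_of_le (by positivity) hM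
  have hN0 : 0 < N := lt_of_lt_of_le hM0 hMN
  have hKd : 0 ≤ K * d := mul_nonneg hK hd.le
  have hΛ0 : 0 < Λ := by linarith
  -- smoothing (NO logarithm)
  have hT1 : K * d * (1 / π + 3 * π ^ 4 / 32) / LF ≤ 170200 * K * d * Λ / L := by
    have hπlo4 : 3.1415 < π := Real.pi_gt_d4
    have hπhi4 : π < 3.1416 := Real.pi_lt_d4
    have h1 : 1 / π ≤ 0.3184 := by rw [div_le_iff₀ hπ]; nlinarith only [hπlo4]
    have hπ2 : π ^ 2 < 3.1416 * 3.1416 := by rw [pow_two]; exact mul_lt_mul'' hπhi4 hπhi4 hπ.le hπ.le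
    have hπ4 : π ^ 4 ≤ 97.42 := by nlinarith only [hπ2, pow_pos hπ 2]
    have h2 : 1 / π + 3 * π ^ 4 / 32 ≤ 9.452 := by linarith only [h1, hπ4]
    have h3 : K * d * (1 / π + 3 * π ^ 4 / 32) / LF ≤ K * d * 9.452 / LF :=
      div_le_div_of_nonneg_right (mul_le_mul_of_nonneg_left h2 hKd) hLF0.le
    refine h3.trans ?_
    rw [div_le_div_iff₀ hLF0 hL0]
    have h4 := mul_le_mul_of_nonneg_left hLLF (by positivity : (0 : ℝ) ≤ K * d * 9.452)
    have h5 : 0 ≤ K * d * Λ * LF := by positivity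
    nlinarith only [h4, h5]
  -- second order (`M ≥ 2π²L_F`)
  have hT2 : K * π * LF / d * (d * π / M) ^ 2 ≤ 1440 * K * d * Λ / L := by
    have e : K * π * LF / d * (d * π / M) ^ 2 = K * d * (π ^ 3 * LF / M ^ 2) := by field_simp
    have hsq : (2 * LF * π * π) ^ 2 ≤ M ^ 2 := pow_le_pow_left₀ (by positivity) hM 2
    have h1 : π ^ 3 * LF / M ^ 2 ≤ 1 / (4 * π * LF) := by
      rw [div_le_div_iff₀ (by positivity) (by positivity)]
      nlinarith only [hsq, hπ, hLF0]
    have h2 : 1 / (4 * π * LF) ≤ 1440 * Λ / L := by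
      rw [div_le_div_iff₀ (by positivity) hL0]
      have h3 : 4 * 3.14 * 1440 * (Λ * LF) ≤ 4 * π * 1440 * (Λ * LF) := by
        have := mul_le_mul_of_nonneg_right hπlo.le (by positivity : (0 : ℝ) ≤ 4 * 1440 * (Λ * LF))
        linarith only [this]
      have h0 : 0 ≤ Λ * LF := by positivity
      linarith only [hLLF, h3, h0]
    rw [e]
    calc K * d * (π ^ 3 * LF / M ^ 2) ≤ K * d * (1440 * Λ / L) := mul_le_mul_of_nonneg_left (h1.trans h2) hKd
      _ = 1440 * K * d * Λ / L := by ring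
  -- first order
  have hT3 : K * (d * π / N) ≤ 54 * K * d / L := by
    have h1 : d * π / N ≤ 54 * d / L := by
      rw [div_le_div_iff₀ hN0 hL0]
      have e1 : d * π * L ≤ 3.15 * (d * L) := by
        rw [show d * π * L = π * (d * L) by ring]
        exact mul_le_mul_of_nonneg_right hπhi.le (by positivity)
      have e2 := mul_le_mul_of_nonneg_left hN17 (by positivity : (0 : ℝ) ≤ 54 * d)
      have e3 : 0 ≤ d * L := by positivity
      linarith only [e1, e2, e3]
    calc K * (d * π / N) ≤ K * (54 * d / L) := mul_le_mul_of_nonneg_left h1 hK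
      _ = 54 * K * d / L := by ring
  -- ladder
  have hT4 : ε * (π ^ 4 * (K * d) * LF / 8) * (1 + 2 * LF * π / d * (d * π / M + d * π / N)) ≤ 19 * K * d / L := by
    have h1 : 2 * LF * π / d * (d * π / M) ≤ 1 := by
      rw [show 2 * LF * π / d * (d * π / M) = 2 * LF * π * π / M by field_simp, div_le_one hM0]; exact hM
    have h2 : 2 * LF * π / d * (d * π / N) ≤ 1 := by
      rw [show 2 * LF * π / d * (d * π / N) = 2 * LF * π * π / N by field_simp, div_le_one hN0]; exact hM.trans hMN
    have h3 : 1 + 2 * LF * π / d * (d * π / M + d * π / N) ≤ 3 := by rw [mul_add]; linarith only [h1, h2]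
    have hπ2 : π ^ 2 < 3.15 * 3.15 := by rw [pow_two]; exact mul_lt_mul'' hπhi hπhi hπ.le hπ.le
    have hπ4 : π ^ 4 ≤ 98.5 := by nlinarith only [hπ2, pow_pos hπ 2]
    have hW : π ^ 4 * (K * d) * LF / 8 ≤ 12.32 * (K * d) * LF := by
      rw [div_le_iff₀ (by norm_num : (0 : ℝ) < 8)]
      have := mul_le_mul_of_nonneg_right hπ4 (by positivity : (0 : ℝ) ≤ K * d * LF)
      have h0 : 0 ≤ K * d * LF := by positivity
      nlinarith only [this, h0]
    have h03 : (0 : ℝ) ≤ 1 + 2 * LF * π / d * (d * π / M + d * π / N) := by positivity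
    have h4 : ε * (π ^ 4 * (K * d) * LF / 8) * (1 + 2 * LF * π / d * (d * π / M + d * π / N)) ≤
        (1 / (2 * L ^ 2)) * (12.32 * (K * d) * LF) * 3 :=
      mul_le_mul (mul_le_mul hε hW (by positivity) (by positivity)) h3 h03 (by positivity)
    refine h4.trans ?_
    rw [show 1 / (2 * L ^ 2) * (12.32 * (K * d) * LF) * 3 = 18.48 * K * d * LF / L ^ 2 by field_simp; ring,
      div_le_div_iff₀ (by positivity) hL0]
    have := mul_le_mul_of_nonneg_left hLFL (by positivity : (0 : ℝ) ≤ 19 * K * d * L)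
    nlinarith only [this, hKd, hL0, hLF0]
  -- total
  have hsum : 170200 * K * d * Λ / L + (1440 * K * d * Λ / L + 54 * K * d / L + 19 * K * d / L) ≤ 171700 * K * d * Λ / L := by
    rw [← add_div, ← add_div, ← add_div]
    refine div_le_div_of_nonneg_right ?_ hL0.le
    nlinarith only [hΛ, hKd]
  linarith only [hT1, hT2, hT3, hT4, hsum]

end Summit.QuantumFields.YangMills.Theorems.BalabanUVNodesN19MomentBudgetLinearParameters

end
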